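import Summits.BirchSwinnertonDyer.BirchSwinnertonDyer.Theorems.ErratumRoadFiveEulerHalfJetchevMaxHLAtPConsumer
import Summits.BirchSwinnertonDyer.BirchSwinnertonDyer.Theorems.ErratumRoadFiveJetchevAtPDisplay
import Summits.BirchSwinnertonDyer.BirchSwinnertonDyer.Theorems.ClassRecordThreeEulerHalvesAtThreePoitouTateOfCanonical
import Summits.BirchSwinnertonDyer.BirchSwinnertonDyer.Theorems.ClassRecordThreeKolyvaginShaOrderDivisibleEnd
import Summits.BirchSwinnertonDyer.Rank1Residual.JET.McCallumProp44ByName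
import HarnessLib

/-!
# Route `ErratumRoadFive` (K2, `p ≥ 5`), crux `EulerHalfNotRamNoInertSetAtFive` (item stmt-BirchSwinnertonDyer-19715), line `birth` v5:
# THE DECIDING STUB `stub_jetchevMaxHLAtP_of_print` VERBATIM, and the residual S1b CLOSED MODULO PRINT + `X11aLowerHalf`
# (cell `bsd-stepL`, lead seat `bsd-line-er5-p1` g0; `--supports stmt-BirchSwinnertonDyer-19715`; RULING 52 port — the JOIN of -w2's layers 1–2 and the lead's layers 3–4)

WHAT. RULING 52 (planner g40, 2026-08-28) made the PORT of tam3-p1's p = 3 kernel chain (`Koly.jetchevMaxHLAtThree_of_facts_of_print`,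
p547155) to a general odd prime the line of attack for 19715's deciding stub; RULING 52′(3) typed the v5 deciding stub to the port's output.
The port is now IN THE TREE: -w2's `AtP.Koly.jetchevMaxHLAtP_of_facts_of_print` (p614031, `…ErratumRoadFiveJetchevAtPDisplay`, over p613260
`…JetchevAtPPerLevel` + p613446 `…JetchevAtPSupply`; general odd `p`, frame binder `d_K ≠ −3`) and the lead's consumer
`JetchevMaxHLAtP.res_pOnlyMultCarrierAtFive_of_jetchevMaxHL_of_lowerX11a` (p612480, `…ErratumRoadFiveEulerHalfJetchevMaxHLAtPConsumer`). This file joins them: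
* §1 `jetchevMaxHLAtP_of_print` — the deciding stub `stub_jetchevMaxHLAtP_of_print` of `Cruxes/EulerHalfNotRamNoInertSetAtFive/Lines/birth.lean` v5 (RULING 53: line of
  record, registration queued), its type VERBATIM under a neutral name (the by-name closer follows once v5 is recorded) (six printed named facts ⟹ Jetchev Thm. 1.4 max-HL at the multiplicative `p ≥ 5`, `d_K < −4` frames): a three-line wrapper over -w2's
  general theorem (`5 ≤ p ⟹ p ≠ 2`, `d_K < −4 ⟹ d_K ≠ −3`).
* §2 `jetchevMaxHLAtP_of_printFacts` — the fact-free HL statement at `p` from the v5 CITABLE bundle `stub_printFactsHeld` (McCallum Prop. 5.2 ∧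
  Gross 1991 Prop. 3.7 (2) image-free ∧ `SelmerComplement` of THE canonical local invariant maps ∧ Gross 1991 §6 ∕ [GZ86 III (3.1)]) + Gross–Zagier +
  modularity: McCallum Prop. 4.4 by bsd-jet's `JET.prop44_of_frobeniusCongruence`, Poitou–Tate by tam3-p1 g10's
  `Koly.poitouTate_conj_forall_of_selmerComplement_canonical`.
* §3 `res_pOnlyMultCarrierAtFive_of_printFacts_of_lowerX11a` — THE LINE'S RESIDUAL S1b (registered text of v2b′∕v4∕v5 VERBATIM: X11b, `p ≥ 5`,
  `ρ̄` onto, ¬(ram), `p ∣ ∏c`, `p` the ONLY multiplicative prime, split at `p`, `p ∣ ord_p Δ_min` ⟹ `Typed.MissingUpperBoundAt W p`; 334 ∕ 404 census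
  pairs) MODULO PRINT AND THE X11a LOWER HALF ONLY: hypotheses = the `PublishedInputsFive` conjuncts hGZ hKo hGZK hmod hnf hHL hMaz, the Cassels–Tate level
  inputs (route item `ShimuraCasselsTateLevelInputs`), the four-fact bundle, and `X11aLowerHalf` as a ∀-statement (route item 19064). No Jetchev
  hypothesis is left: the Euler-system half on the exceptional-zero core is a kernel theorem modulo printed facts + the twist's lower half.
* §4 `rung_res_605a1_of_printFacts_of_lowerX11a` — the plan-only rung `stub_rung_res_605a1` (S1b at (605a1, 5), registered text VERBATIM as
  conclusion) from §3, same hypotheses.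

HONEST FRAMING: THEOREMS ONLY, Theses-free, no `sorry`, no new definition or named fact; CONDITIONAL on the displayed printed facts (McCallum Prop. 5.2
carries the flag `Kolyvagin1991-LNM1479-primary-unread`, acq-08093; `SelmerComplement` of the canonical family = Milne ADT I 4.10(b), typed not proved;
Gross 1991 §6 ∕ GZ III (3.1) typed not proved; Gross 1991 Prop. 3.7 (2) typed not proved) and, in §3–§4, on `X11aLowerHalf` (OPEN crux 19064) — a
`conditional-result`; nothing is booked; 19715 is NOT closed (S2b and the HELD split primitives remain, and the facts are hypotheses); BSD is proved for
NO curve; no summit statement is touched. Credit: -w2 (layers 1–2 of the port, p613260 p613446 p614031), tam3-p1 (the p = 3 originals and the g9∕g10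
derivations), bsd-jet (`McCallumProp44ByName`), corner-p1, x11b3.
References (locators only): [cite: Jetchev2008, Thm. 1.4 (p. 812), Cor. 1.5] [cite: McCallumLMS1991, §4 Prop. 4.4, §5 Prop. 5.2, Cor. 5.6]
[cite: GrossLMS1991, Prop. 3.7 (2), §6 Prop. 6.2 (1)] [cite: GrossZagier1986, I (6.3), III (3.1)] [cite: MilneADT2006, Ch. I, Thm. 4.10(b)]
[cite: Howard2004HeegnerKolyvagin, Thm. 2.1.11] [cite: Cremona1997, Table 1 (605a1)].
-/

set_option autoImplicit false
set_option linter.dupNamespace false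

noncomputable section

open scoped Classical

namespace Summit.BirchSwinnertonDyer.BirchSwinnertonDyer.Theorems.JetchevMaxHLAtP

open WeierstrassCurve NumberField IsDedekindDomain
  Literature.NumberTheory.EllipticCurves
  Literature.NumberTheory.EllipticCurves.ModularForms
  Literature.NumberTheory.EllipticCurves.Rank1Residual
  Literature.NumberTheory.EllipticCurves.Rank1Residual.Typed
  Summit.BirchSwinnertonDyer.Rank1Residual Summit.BirchSwinnertonDyer.Rank1Residual.X11b
  Summit.BirchSwinnertonDyer.Rank1Residual.X11b.Three.Koly

/-! ### §1 The registered deciding stub of line `birth` v5, VERBATIM -/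

/-- **`jetchevMaxHLAtP_of_print` — the TYPE of the DECIDING STUB `stub_jetchevMaxHLAtP_of_print` of `Cruxes/EulerHalfNotRamNoInertSetAtFive/Lines/birth.lean` v5, VERBATIM** (landed under a neutral name while v5's registration is queued behind the farm; the ≤ 5-line closer `theorem stub_jetchevMaxHLAtP_of_print := jetchevMaxHLAtP_of_print` follows on registration, RULING 53 (2)):
McCallum Prop. 5.2 → McCallum Prop. 4.4 → Gross–Zagier → modularity → Poitou–Tate for Selmer structures → Gross 1991 §6 ∕ [GZ86 III (3.1)] →
for every globally minimal `W/ℚ`, prime `p ≥ 5` with `r_an(E) = 1`, `E` multiplicative at `p`, `ρ̄_{E,p}` onto, every imaginary quadratic Heegner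
`K` with `d_K` odd, `d_K < −4`, `L(E^{d_K},1) ≠ 0`, every Manin-good conductor-1 frame, every finite place `v` (the place of `p` included), every
`s ≤ ord_p c_v(E)`, every squarefree Kolyvagin level of index `≥ s`: `PDiv d p s`. PROOF: -w2's p-generic port
`AtP.Koly.jetchevMaxHLAtP_of_facts_of_print` (p614031) at `p ≠ 2` (from `5 ≤ p`) and `d_K ≠ −3` (from `d_K < −4`). CONDITIONAL on the six facts
(hypotheses). [cite: Jetchev2008, Thm. 1.4 (p. 812)] [cite: McCallumLMS1991, §4 Prop. 4.4, §5 Prop. 5.2] [cite: GrossLMS1991, §6 Prop. 6.2 (1)] -/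
theorem jetchevMaxHLAtP_of_print :
    Literature.NumberTheory.EllipticCurves.McCallum1991.prop52_exists_conductor_kolyvaginClass_order_eq →
    Literature.NumberTheory.EllipticCurves.McCallum1991.prop44_localOrder_kolyvaginClass_mul_eq →
    (∀ (N : ℕ) [NeZero N] (W : WeierstrassCurve ℚ) (K : Type) [Field K] [NumberField K],
      Literature.NumberTheory.EllipticCurves.gross_zagier N W K) →
    WeierstrassCurve.hasEntireLFunction_rat →
    (∀ (K : Type) [Field K] [NumberField K], Literature.NumberTheory.GaloisCohomology.poitouTate_selmerStructure_duality_conj K) →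
    Literature.NumberTheory.EllipticCurves.Gross1991_heegnerPoint_sub_ratTorsion_mem_E0 →
    ∀ (W : WeierstrassCurve ℚ) [W.IsElliptic] [W.IsGloballyMinimal] (p : ℕ) [Fact p.Prime]
      [NeZero (W.conductorNorm ℤ)] (K : Type) [Field K] [NumberField K]
      (Dt : Literature.NumberTheory.EllipticCurves.ModularForms.ModularParametrizationData W (W.conductorNorm ℤ)) (β : ℤ) (ι : K →+* ℂ),
      5 ≤ p → W.analyticRank = 1 → W.HasMultiplicativeReductionAtPrime p → Literature.NumberTheory.EllipticCurves.Rank1Residual.Surj W p →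
      Literature.NumberTheory.EllipticCurves.IsImaginaryQuadratic K →
      Literature.NumberTheory.EllipticCurves.SatisfiesHeegnerHypothesis (W.conductorNorm ℤ) K →
      Odd (NumberField.discr K) → NumberField.discr K < -4 →
      (W.quadraticTwist (NumberField.discr K : ℚ)).entireLFunction 1 ≠ 0 →
      (4 * (W.conductorNorm ℤ : ℤ)) ∣ β ^ 2 - NumberField.discr K → ¬ (p : ℤ) ∣ Dt.c →
      ∀ (v : IsDedekindDomain.HeightOneSpectrum (NumberField.RingOfIntegers ℚ)) (s : ℕ), s ≤ padicValNat p (W.tamagawaNumberAt v) →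
        ∀ (n : ℕ) (d : Literature.NumberTheory.EllipticCurves.KolyvaginHeegnerData Dt β ι n), Squarefree n →
          (∀ ℓ ∈ n.primeFactors, Literature.NumberTheory.EllipticCurves.Zhang2014.IsKolyvaginPrime (W.conductorNorm ℤ) W K p ℓ ∧
            s ≤ Literature.NumberTheory.EllipticCurves.Zhang2014.kolyvaginIndex W p ℓ) →
          Summit.BirchSwinnertonDyer.Rank1Residual.X11b.Three.Koly.PDiv d p s := by
  intro h52 h44 hGZ hmod hPT hF1 W _ _ p _ _ K _ _ Dt β ι hp5 hr hmult hρ hK hHN hodd hD hL hβ hc v s hs n d hsq hkol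
  exact AtP.Koly.jetchevMaxHLAtP_of_facts_of_print p (by omega) h52 h44 hGZ hmod hPT hF1 W K Dt β ι hr hmult hρ hK hHN
    hodd (by omega) hL hβ hc v s hs n d hsq hkol

/-! ### §2 The fact-free HL statement at `p` from the v5 citable bundle -/

/-- **Jetchev Thm. 1.4 (max form) at the multiplicative `p ≥ 5`, HL currency, from the v5 CITABLE bundle `stub_printFactsHeld`** (McCallum Prop.
5.2 ∧ Gross 1991 Prop. 3.7 (2) image-free ∧ `SelmerComplement` of the canonical invariant maps ∧ Gross 1991 §6) **+ Gross–Zagier + modularity**: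
Prop. 4.4 by `JET.prop44_of_frobeniusCongruence`, Poitou–Tate by `Koly.poitouTate_conj_forall_of_selmerComplement_canonical`, then §1.
CONDITIONAL on the displayed facts. [cite: Jetchev2008, Thm. 1.4] [cite: McCallumLMS1991, §4 Prop. 4.4] [cite: MilneADT2006, Ch. I, Thm. 4.10(b)] -/
theorem jetchevMaxHLAtP_of_printFacts
    (hF :
    Literature.NumberTheory.EllipticCurves.McCallum1991.prop52_exists_conductor_kolyvaginClass_order_eq ∧
    Literature.NumberTheory.EllipticCurves.GrossLMS1991.prop37_2_frobeniusCongruence ∧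
    (∀ (K : Type) [Field K] [NumberField K] (n : ℕ) [NeZero n],
      (Literature.NumberTheory.GaloisCohomology.LocalInvariants.canonical K n).SelmerComplement) ∧
    Literature.NumberTheory.EllipticCurves.Gross1991_heegnerPoint_sub_ratTorsion_mem_E0)
    (hGZ : ∀ (N : ℕ) [NeZero N] (W : WeierstrassCurve ℚ) (K : Type) [Field K] [NumberField K], gross_zagier N W K)
    (hmod : hasEntireLFunction_rat) :
    ∀ (W : WeierstrassCurve ℚ) [W.IsElliptic] [W.IsGloballyMinimal] (p : ℕ) [Fact p.Prime]
      [NeZero (W.conductorNorm ℤ)] (K : Type) [Field K] [NumberField K]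
      (Dt : Literature.NumberTheory.EllipticCurves.ModularForms.ModularParametrizationData W (W.conductorNorm ℤ)) (β : ℤ) (ι : K →+* ℂ),
      5 ≤ p → W.analyticRank = 1 → W.HasMultiplicativeReductionAtPrime p → Literature.NumberTheory.EllipticCurves.Rank1Residual.Surj W p →
      Literature.NumberTheory.EllipticCurves.IsImaginaryQuadratic K →
      Literature.NumberTheory.EllipticCurves.SatisfiesHeegnerHypothesis (W.conductorNorm ℤ) K →
      Odd (NumberField.discr K) → NumberField.discr K < -4 →
      (W.quadraticTwist (NumberField.discr K : ℚ)).entireLFunction 1 ≠ 0 →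
      (4 * (W.conductorNorm ℤ : ℤ)) ∣ β ^ 2 - NumberField.discr K → ¬ (p : ℤ) ∣ Dt.c →
      ∀ (v : IsDedekindDomain.HeightOneSpectrum (NumberField.RingOfIntegers ℚ)) (s : ℕ), s ≤ padicValNat p (W.tamagawaNumberAt v) →
        ∀ (n : ℕ) (d : Literature.NumberTheory.EllipticCurves.KolyvaginHeegnerData Dt β ι n), Squarefree n →
          (∀ ℓ ∈ n.primeFactors, Literature.NumberTheory.EllipticCurves.Zhang2014.IsKolyvaginPrime (W.conductorNorm ℤ) W K p ℓ ∧
            s ≤ Literature.NumberTheory.EllipticCurves.Zhang2014.kolyvaginIndex W p ℓ) →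
          Summit.BirchSwinnertonDyer.Rank1Residual.X11b.Three.Koly.PDiv d p s :=
  jetchevMaxHLAtP_of_print hF.1 (JET.prop44_of_frobeniusCongruence hF.2.1) hGZ hmod
    (poitouTate_conj_forall_of_selmerComplement_canonical hF.2.2.1) hF.2.2.2

/-! ### §3 The line's residual S1b, closed modulo print and the X11a lower half -/

/-- **S1b — the exceptional-zero core of crux 19715 (`p ≥ 5` the ONLY multiplicative prime, split, `p ∣ ord_p Δ_min`; registered text of
`Lines/birth.lean` VERBATIM as conclusion) MODULO PRINTED FACTS AND THE X11a LOWER HALF ONLY.** Hypotheses: Gross–Zagier, Kolyvagin, GZK rank,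
modularity, newforms, Hoffstein–Luo, Mazur's Manin constant (conjuncts of `PublishedInputsFive`); the Cassels–Tate level inputs (`ShimuraCasselsTateLevelInputs`);
the four-fact bundle of v5; the X11a lower half at every pair (crux 19064 as a ∀-statement). PROOF: the lead's consumer
`res_pOnlyMultCarrierAtFive_of_jetchevMaxHL_of_lowerX11a` (p612480) fed with §2, McCallum Cor. 5.6 upper by tam3-p1 g9's
`McCallum1991_padicValNat_card_sha_primary_add_le_of_globalDivisibility_of_casselsTate_of_frobeniusCongruence_of_E0`, and the Literature THEOREMS
`heegnerPointOfConductor_one_galoisConj_holds` ∕ `phi_heegnerTau_mem_singularModuliField_holds`. CONDITIONAL (printed facts + open 19064); no pair booked.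
[cite: Jetchev2008, Thm. 1.4, Cor. 1.5] [cite: McCallumLMS1991, Cor. 5.6] [cite: GrossLMS1991, §4 (4.1)] [cite: Miller2011LMS, Def. 1.1] -/
theorem res_pOnlyMultCarrierAtFive_of_printFacts_of_lowerX11a
    (hGZ : ∀ (N : ℕ) [NeZero N] (W : WeierstrassCurve ℚ) (K : Type) [Field K] [NumberField K], gross_zagier N W K)
    (hKo : ∀ (N : ℕ) [NeZero N] (W : WeierstrassCurve ℚ) (K : Type) [Field K] [NumberField K], kolyvagin N W K)
    (hGZK : rank_eq_analyticRank_of_analyticRank_le_one) (hmod : hasEntireLFunction_rat)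
    (hnf : exists_isNewformOf) (hHL : HoffsteinLuo1997_exists_twist_L_one_ne_zero)
    (hMaz : mazur_not_dvd_maninConstant_of_odd)
    (hCTi : ∀ (K : Type) [Field K] [NumberField K], casselsTate_levelInputs K)
    (hF :
    Literature.NumberTheory.EllipticCurves.McCallum1991.prop52_exists_conductor_kolyvaginClass_order_eq ∧
    Literature.NumberTheory.EllipticCurves.GrossLMS1991.prop37_2_frobeniusCongruence ∧
    (∀ (K : Type) [Field K] [NumberField K] (n : ℕ) [NeZero n],
      (Literature.NumberTheory.GaloisCohomology.LocalInvariants.canonical K n).SelmerComplement) ∧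
    Literature.NumberTheory.EllipticCurves.Gross1991_heegnerPoint_sub_ratTorsion_mem_E0)
    (hX11a : ∀ (Wd : WeierstrassCurve ℚ) [Wd.IsElliptic] [Wd.IsGloballyMinimal] (p : ℕ) [Fact p.Prime],
      ClassX11a Wd p → Typed.MissingLowerBoundAt Wd p) :
    ∀ (W : WeierstrassCurve ℚ) [W.IsElliptic] [W.IsGloballyMinimal] (p : ℕ) [Fact p.Prime], Summit.BirchSwinnertonDyer.Rank1Residual.ClassX11b W p → 5 ≤ p → Literature.NumberTheory.EllipticCurves.Rank1Residual.Surj W p → ¬ Literature.NumberTheory.EllipticCurves.Rank1Residual.Ram W p → p ∣ W.tamagawaProduct → (∀ (ℓ : ℕ) [Fact ℓ.Prime], W.HasMultiplicativeReductionAtPrime ℓ → ℓ = p) → W.HasSplitMultiplicativeReductionAtPrime p → p ∣ padicValInt p W.minimalDiscriminantInt → Literature.NumberTheory.EllipticCurves.Rank1Residual.Typed.MissingUpperBoundAt W p :=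
  res_pOnlyMultCarrierAtFive_of_jetchevMaxHL_of_lowerX11a hGZ hKo hGZK hmod hnf hHL hMaz
    (fun N _ W K _ _ ↦ heegnerPointOfConductor_one_galoisConj_holds N W K)
    (fun N _ W K _ _ ↦ phi_heegnerTau_mem_singularModuliField_holds N W K)
    (McCallum1991_padicValNat_card_sha_primary_add_le_of_globalDivisibility_of_casselsTate_of_frobeniusCongruence_of_E0
      hCTi hF.2.1 hF.2.2.2)
    (jetchevMaxHLAtP_of_printFacts hF hGZ hmod) hX11a

/-! ### §4 The rung at (605a1, 5) -/

/-- **Rung `stub_rung_res_605a1` of line `birth` (the smallest R1a census pair (605a1, 5) = `[1,−1,0,−1414,−44027]`, `N = 605 = 5·11²`, the only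
multiplicative prime is 5, split, `ord₅ Δ_min = 5`; registered text VERBATIM as conclusion) from §3 — same displayed hypotheses.** CONDITIONAL; the
curve-side premises (X11b, surjectivity, ¬(ram), `5 ∣ ∏c`, only-multiplicative, split, `5 ∣ ord₅ Δ`) stay hypotheses of the rung as registered.
[cite: Cremona1997, Table 1 (605a1)] [cite: Jetchev2008, Cor. 1.5] -/
theorem rung_res_605a1_of_printFacts_of_lowerX11a
    (hGZ : ∀ (N : ℕ) [NeZero N] (W : WeierstrassCurve ℚ) (K : Type) [Field K] [NumberField K], gross_zagier N W K)
    (hKo : ∀ (N : ℕ) [NeZero N] (W : WeierstrassCurve ℚ) (K : Type) [Field K] [NumberField K], kolyvagin N W K)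
    (hGZK : rank_eq_analyticRank_of_analyticRank_le_one) (hmod : hasEntireLFunction_rat)
    (hnf : exists_isNewformOf) (hHL : HoffsteinLuo1997_exists_twist_L_one_ne_zero)
    (hMaz : mazur_not_dvd_maninConstant_of_odd)
    (hCTi : ∀ (K : Type) [Field K] [NumberField K], casselsTate_levelInputs K)
    (hF :
    Literature.NumberTheory.EllipticCurves.McCallum1991.prop52_exists_conductor_kolyvaginClass_order_eq ∧
    Literature.NumberTheory.EllipticCurves.GrossLMS1991.prop37_2_frobeniusCongruence ∧
    (∀ (K : Type) [Field K] [NumberField K] (n : ℕ) [NeZero n],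
      (Literature.NumberTheory.GaloisCohomology.LocalInvariants.canonical K n).SelmerComplement) ∧
    Literature.NumberTheory.EllipticCurves.Gross1991_heegnerPoint_sub_ratTorsion_mem_E0)
    (hX11a : ∀ (Wd : WeierstrassCurve ℚ) [Wd.IsElliptic] [Wd.IsGloballyMinimal] (p : ℕ) [Fact p.Prime],
      ClassX11a Wd p → Typed.MissingLowerBoundAt Wd p)
    [((⟨1, -1, 0, -1414, -44027⟩ : WeierstrassCurve ℤ).baseChange ℚ).IsElliptic] [((⟨1, -1, 0, -1414, -44027⟩ : WeierstrassCurve ℤ).baseChange ℚ).IsGloballyMinimal] [Fact (Nat.Prime 5)] :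
    Summit.BirchSwinnertonDyer.Rank1Residual.ClassX11b ((⟨1, -1, 0, -1414, -44027⟩ : WeierstrassCurve ℤ).baseChange ℚ) 5 → 5 ≤ 5 → Literature.NumberTheory.EllipticCurves.Rank1Residual.Surj ((⟨1, -1, 0, -1414, -44027⟩ : WeierstrassCurve ℤ).baseChange ℚ) 5 → ¬ Literature.NumberTheory.EllipticCurves.Rank1Residual.Ram ((⟨1, -1, 0, -1414, -44027⟩ : WeierstrassCurve ℤ).baseChange ℚ) 5 → 5 ∣ ((⟨1, -1, 0, -1414, -44027⟩ : WeierstrassCurve ℤ).baseChange ℚ).tamagawaProduct → (∀ (ℓ : ℕ) [Fact ℓ.Prime], ((⟨1, -1, 0, -1414, -44027⟩ : WeierstrassCurve ℤ).baseChange ℚ).HasMultiplicativeReductionAtPrime ℓ → ℓ = 5) → ((⟨1, -1, 0, -1414, -44027⟩ : WeierstrassCurve ℤ).baseChange ℚ).HasSplitMultiplicativeReductionAtPrime 5 → 5 ∣ padicValInt 5 ((⟨1, -1, 0, -1414, -44027⟩ : WeierstrassCurve ℤ).baseChange ℚ).minimalDiscriminantInt → Literature.NumberTheory.EllipticCurves.Rank1Residual.Typed.MissingUpperBoundAt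 ((⟨1, -1, 0, -1414, -44027⟩ : WeierstrassCurve ℤ).baseChange ℚ) 5 :=
  res_pOnlyMultCarrierAtFive_of_printFacts_of_lowerX11a hGZ hKo hGZK hmod hnf hHL hMaz hCTi hF hX11a _ 5

end Summit.BirchSwinnertonDyer.BirchSwinnertonDyer.Theorems.JetchevMaxHLAtP

end
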